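import Summits.BirchSwinnertonDyer.BirchSwinnertonDyer.Theorems.SignedLowerHalvesSmallImageLowerHalfBothSignsLambdaLowerThreeNsThetaPartnerLevelMatchAlgebra
import Literature.NumberTheory.GaloisRepresentations.ResidualRepOfCongruentFrobenius
import HarnessLib

/-!
# An element of `ℓ`-power order acts trivially on a `p`-adic representation iff it acts trivially on the
# residual representation; transfer of triviality along a residual isomorphism (brick LM-D of `stub_levelMatch_ns`)

Route `SignedLowerHalves`, child L `SmallImageLowerHalfBothSigns` (item stmt-BirchSwinnertonDyer-23599), line `rtt_w3`
(skeleton of record v2, stub `stub_levelMatch_ns`; width seat `bsd-line-slh-p3-w3` gen 10; memo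
`Lines/birth_acns-MEMO-w3-g10.md` §4).  THEOREMS ONLY (no definition, no named fact, no `sorry`); ROUTE-INDEPENDENT.

For `ρ : G → GL_n(F)` with an integral model over a valuation ring `O ⊆ F`, a reduction `τ₀ = Q (ρ₀ mod 𝔪) Q⁻¹`
(`IsReductionOf`) and a semisimplification `τ` of `τ₀` (`IsSemisimplificationOf`; `IsResidualRepOf = ∃ τ₀, …`), and an
element `g` with `ρ(g)^N = 1`, `N` a unit of `O` (the wild inertia at `ℓ ≠ p`, brick LM-F):

* `IsReductionOf.pow_eq_one`, `IsReductionOf.apply_eq_one_iff` — `τ₀(g)^N = 1`, and `ρ(g) = 1 ↔ τ₀(g) = 1`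
  (brick LM-A: an element of `GL_n(O)` of order prime to the residue characteristic which is `≡ 1 (mod 𝔪)` is `1`);
* `Matrix.eq_one_of_charpoly_eq_of_pow_eq_one`, `IsSemisimplificationOf.apply_eq_one_iff` (rank `2`) —
  `τ(g) = 1 ↔ τ₀(g) = 1`: a `2 × 2` matrix with the characteristic polynomial of `1` and order prime to the
  characteristic is `1` (it is unipotent with a fixed vector and determinant `1`, brick LM-A);
* `FramedGaloisRep.apply_eq_one_iff_of_isResidualRepOf_equiv` — hence for two `p`-adic representations
  `ρ, ρ' : Γ_K → GL₂(ℚ̄_p)` with ISOMORPHIC residual representations and `σ` with `ρ(σ)^N = ρ'(σ)^N = 1`, `p ∤ N`: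
  `ρ(σ) = 1 ↔ ρ'(σ) = 1` (equivalent representations through `GL₂(k)` have the same kernel,
  `ker_eq_of_equiv_glRepresentation`).  With the tree's "congruent Frobenius polynomials ⇒ isomorphic residual
  representations" (`FramedGaloisRep.nonempty_equiv_of_isResidualRepOf_of_congruent`) this is the `htriv` input of
  brick LM-C for `ρ_g` versus `V_p(W)`.

BSD, crux L and the stub are NOT proved here.

References: H. Darmon, F. Diamond, R. Taylor, Fermat's Last Theorem (1995) §2.1; J.-P. Serre, Duke 54 (1987) §3; folklore.
-/

set_option autoImplicit false
set_option linter.dupNamespace false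

noncomputable section

open scoped MatrixGroups NumberField
open Module Matrix IsLocalRing Polynomial

namespace Summit.BirchSwinnertonDyer.BirchSwinnertonDyer.Theorems.SmallImageLambdaLowerThreeNsThetaPartner

open Literature.NumberTheory.GaloisRepresentations

/-! ### Reductions detect triviality of elements of order prime to the residue characteristic -/

section Reduction

variable {F : Type*} [Field F] {O : ValuationSubring F} {k : Type*} [Field k] {ι : ResidueField O →+* k} {n : ℕ}
  {G : Type*} [Group G]

/-- `GL_n` of the inclusion of a valuation ring into its field is injective. [folklore] -/
theorem GeneralLinearGroup.map_subtype_injective :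
    Function.Injective (Matrix.GeneralLinearGroup.map (n := Fin n) O.subtype) := by
  intro x y h
  apply Units.ext
  have h' := congrArg (fun z : GL (Fin n) F => (z : Matrix (Fin n) (Fin n) F)) h
  simpa [Matrix.GeneralLinearGroup.map_apply] using
    (Matrix.map_injective (f := (O.subtype : O → F)) Subtype.val_injective) (by simpa using h')

/-- Conjugation commutes with powers: `(a⁻¹ b a)^i = a⁻¹ b^i a`. [folklore] -/
theorem inv_mul_mul_pow {M : Type*} [Group M] (a b : M) (i : ℕ) : (a⁻¹ * b * a) ^ i = a⁻¹ * b ^ i * a := by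
  have h := conj_pow (a := a⁻¹) (b := b) (i := i)
  rwa [inv_inv] at h

/-- In an integral model, `ρ₀(g)^N = 1 ↔ ρ(g)^N = 1` (so also `ρ₀(g) = 1 ↔ ρ(g) = 1`, `N = 1`). [folklore] -/
theorem IsIntegralModelOf.pow_eq_one_iff {ρ : G →* GL (Fin n) F} {ρ₀ : G →* GL (Fin n) O} (h : IsIntegralModelOf ρ ρ₀)
    (g : G) (N : ℕ) : ρ₀ g ^ N = 1 ↔ ρ g ^ N = 1 := by
  obtain ⟨P, hP⟩ := h
  have hmap : Matrix.GeneralLinearGroup.map O.subtype (ρ₀ g ^ N) = P⁻¹ * ρ g ^ N * P := by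
    rw [map_pow, hP g, inv_mul_mul_pow]
  constructor
  · intro h1
    rw [h1, map_one] at hmap
    have : ρ g ^ N = P * (P⁻¹ * ρ g ^ N * P) * P⁻¹ := by group
    rw [this, ← hmap]
    group
  · intro h1
    apply GeneralLinearGroup.map_subtype_injective
    rw [hmap, h1, map_one]
    group

/-- **A reduction has the torsion of the representation**: `ρ(g)^N = 1 ⇒ τ₀(g)^N = 1`. [folklore] -/
theorem IsReductionOf.pow_eq_one {ρ : G →* GL (Fin n) F} {τ₀ : G →* GL (Fin n) k} (h : IsReductionOf ι ρ τ₀) {g : G}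
    {N : ℕ} (hpow : ρ g ^ N = 1) : τ₀ g ^ N = 1 := by
  obtain ⟨ρ₀, Q, hmodel, hτ₀⟩ := h
  have h0 : ρ₀ g ^ N = 1 := (IsIntegralModelOf.pow_eq_one_iff hmodel g N).mpr hpow
  have hred : integralReduction ι ρ₀ g ^ N = 1 := by
    rw [← map_pow, integralReduction, MonoidHom.comp_apply, map_pow ρ₀, h0, map_one]
  rw [hτ₀ g]
  have hconj : (Q * integralReduction ι ρ₀ g * Q⁻¹) ^ N = Q * (integralReduction ι ρ₀ g) ^ N * Q⁻¹ := conj_pow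
  rw [hconj, hred, mul_one, mul_inv_cancel]

/-- **Reductions detect triviality of elements of order prime to the residue characteristic.**  If `τ₀` is a reduction
of `ρ : G → GL_n(F)` (relative to the valuation ring `O ⊆ F`) and `ρ(g)^N = 1` with `N` a unit of `O`, then
`ρ(g) = 1 ↔ τ₀(g) = 1` (brick LM-A `Matrix.eq_one_of_map_residue_eq_one_of_pow_eq_one`).
[cite: DarmonDiamondTaylor1995, §2.1, p. 54] -/
theorem IsReductionOf.apply_eq_one_iff {ρ : G →* GL (Fin n) F} {τ₀ : G →* GL (Fin n) k} (h : IsReductionOf ι ρ τ₀)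
    {g : G} {N : ℕ} (hN : IsUnit ((N : ℕ) : O)) (hpow : ρ g ^ N = 1) : ρ g = 1 ↔ τ₀ g = 1 := by
  obtain ⟨ρ₀, Q, hmodel, hτ₀⟩ := h
  have h0N : ρ₀ g ^ N = 1 := (IsIntegralModelOf.pow_eq_one_iff hmodel g N).mpr hpow
  have hiff0 : ρ g = 1 ↔ ρ₀ g = 1 := by
    have := IsIntegralModelOf.pow_eq_one_iff hmodel g 1
    simpa using this.symm
  rw [hiff0, hτ₀ g]
  constructor
  · intro h1
    rw [integralReduction, MonoidHom.comp_apply, h1, map_one, mul_one, mul_inv_cancel]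
  · intro h1
    have hred : integralReduction ι ρ₀ g = 1 := by
      have : integralReduction ι ρ₀ g = Q⁻¹ * (Q * integralReduction ι ρ₀ g * Q⁻¹) * Q := by group
      rw [this, h1]
      group
    -- entrywise: `ι (residue (ρ₀ g i j)) = 1 i j`, hence `(ρ₀ g).map residue = 1`
    have hredM : (((ρ₀ g : GL (Fin n) O) : Matrix (Fin n) (Fin n) O).map (residue O)).map ι = 1 := by
      have := congrArg (fun z : GL (Fin n) k => (z : Matrix (Fin n) (Fin n) k)) hred
      simp only [integralReduction, MonoidHom.comp_apply, Units.val_one] at this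
      rw [← this, Matrix.map_map]
      rfl
    have hres : ((ρ₀ g : GL (Fin n) O) : Matrix (Fin n) (Fin n) O).map (residue O) = 1 := by
      apply Matrix.map_injective ι.injective
      change (((ρ₀ g : GL (Fin n) O) : Matrix (Fin n) (Fin n) O).map (residue O)).map ι = (1 : Matrix (Fin n) (Fin n) _).map ι
      rw [hredM, Matrix.map_one ι (map_zero ι) (map_one ι)]
    have hpowM : ((ρ₀ g : GL (Fin n) O) : Matrix (Fin n) (Fin n) O) ^ N = 1 := by
      rw [← Units.val_pow_eq_pow_val, h0N, Units.val_one]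
    exact Units.ext (Matrix.eq_one_of_map_residue_eq_one_of_pow_eq_one hres hN hpowM)

end Reduction

/-! ### Semisimplifications detect triviality of elements of order prime to the characteristic (rank `2`) -/

section Semisimplification

variable {k : Type*} [Field k] {G : Type*} [Group G]

/-- **A `2 × 2` matrix with the characteristic polynomial of the identity and order prime to the characteristic is the
identity**: it has determinant `1` and a fixed vector (`det(1 - A) = χ_A(1) = χ_1(1) = 0`), so brick LM-A applies.
[folklore] -/
theorem Matrix.eq_one_of_charpoly_eq_of_pow_eq_one {A : Matrix (Fin 2) (Fin 2) k}
    (hchar : A.charpoly = (1 : Matrix (Fin 2) (Fin 2) k).charpoly) {N : ℕ} (hN : (N : k) ≠ 0) (hpow : A ^ N = 1) :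
    A = 1 := by
  classical
  -- determinant `1`
  have hdet : A.det = 1 := by
    rw [Matrix.det_eq_sign_charpoly_coeff, hchar, ← Matrix.det_eq_sign_charpoly_coeff, Matrix.det_one]
  -- a fixed vector: `det (scalar 1 - A) = χ_A(1) = χ_1(1) = det 0 = 0`
  have hsing : (Matrix.scalar (Fin 2) (1 : k) - A).det = 0 := by
    rw [← Matrix.eval_charpoly, hchar, Matrix.eval_charpoly]
    simp
  obtain ⟨v, hv, hAv⟩ := Matrix.exists_mulVec_eq_zero_iff.mpr hsing
  have hfix : A *ᵥ v = v := by
    rw [Matrix.sub_mulVec, sub_eq_zero] at hAv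
    rw [← hAv]
    simp
  -- brick LM-A on `toLin' A`
  have h2 : finrank k (Fin 2 → k) = 2 := by simp
  have hu : Matrix.toLin' A = 1 := by
    refine LinearMap.eq_one_of_apply_eq_of_det_eq_one_of_pow_eq_one h2 (Matrix.toLin' A) hv ?_ ?_ hN ?_
    · rw [Matrix.toLin'_apply, hfix]
    · rw [LinearMap.det_toLin', hdet]
    · rw [← Matrix.toLin'_pow, hpow, Matrix.toLin'_one]
      rfl
  apply Matrix.toLin'.injective
  rw [hu, Matrix.toLin'_one]
  rfl

/-- **Semisimplifications detect triviality of elements of order prime to the characteristic** (rank `2`): if `τ` is a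
semisimplification of `τ₀ : G → GL₂(k)` and `τ₀(g)^N = 1` with `(N : k) ≠ 0`, then `τ(g) = 1 ↔ τ₀(g) = 1`
(`⇐`: `ker τ₀ ≤ ker τ`; `⇒`: `τ₀(g)` has the characteristic polynomial of `τ(g) = 1`).
[cite: DarmonDiamondTaylor1995, §2.1, p. 54] -/
theorem IsSemisimplificationOf.apply_eq_one_iff {τ τ₀ : G →* GL (Fin 2) k} (h : IsSemisimplificationOf τ τ₀) {g : G}
    {N : ℕ} (hN : (N : k) ≠ 0) (hpow : τ₀ g ^ N = 1) : τ g = 1 ↔ τ₀ g = 1 := by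
  obtain ⟨_, hcp, hker⟩ := h
  constructor
  · intro h1
    have hchar : ((τ₀ g : GL (Fin 2) k) : Matrix (Fin 2) (Fin 2) k).charpoly =
        (1 : Matrix (Fin 2) (Fin 2) k).charpoly := by
      rw [← hcp g, h1, Units.val_one]
    have hpowM : ((τ₀ g : GL (Fin 2) k) : Matrix (Fin 2) (Fin 2) k) ^ N = 1 := by
      rw [← Units.val_pow_eq_pow_val, hpow, Units.val_one]
    exact Units.ext (Matrix.eq_one_of_charpoly_eq_of_pow_eq_one hchar hN hpowM)
  · intro h1
    exact hker (by rwa [MonoidHom.mem_ker])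

end Semisimplification

/-! ### Transfer along a residual isomorphism (`ρ, ρ' : Γ_K → GL₂(ℚ̄_p)`) -/

section Residual

variable {K : Type} [Field K] [NumberField K] {p : ℕ} [Fact p.Prime]

/-- A unit of `ℤ̄_p` is non-zero in the residue field `ℤ̄_p/𝔪`. [folklore] -/
theorem residue_natCast_ne_zero_of_isUnit {N : ℕ} (hN : IsUnit ((N : ℕ) : padicAlgClIntegers p)) :
    ((N : ℕ) : padicAlgClResidueField p) ≠ 0 := by
  have h := (hN.map (residue (padicAlgClIntegers p))).ne_zero
  rwa [map_natCast] at h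

omit [NumberField K] in
/-- **Residual representations detect triviality of elements of order prime to `p`**: for
`ρ : Γ_K → GL₂(ℚ̄_p)` with residual representation `τ` and `σ` with `ρ(σ)^N = 1`, `N ∈ ℤ̄_pˣ`:
`ρ(σ) = 1 ↔ τ(σ) = 1`. [cite: DarmonDiamondTaylor1995, §2.1, p. 54] -/
theorem FramedGaloisRep.apply_eq_one_iff_of_isResidualRepOf (ρ : FramedGaloisRep K (PadicAlgCl p) 2)
    {τ : Field.absoluteGaloisGroup K →* GL (Fin 2) (padicAlgClResidueField p)}
    (hτ : ρ.IsResidualRepOf (RingHom.id _) τ) {σ : Field.absoluteGaloisGroup K} {N : ℕ}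
    (hN : IsUnit ((N : ℕ) : padicAlgClIntegers p)) (hpow : ρ σ ^ N = 1) : ρ σ = 1 ↔ τ σ = 1 := by
  obtain ⟨τ₀, hred, hss⟩ := hτ
  have hpow' : (ρ : Field.absoluteGaloisGroup K →* GL (Fin 2) (PadicAlgCl p)) σ ^ N = 1 := hpow
  have h1 : ρ σ = 1 ↔ τ₀ σ = 1 := IsReductionOf.apply_eq_one_iff hred hN hpow'
  rw [h1]
  exact (IsSemisimplificationOf.apply_eq_one_iff hss (residue_natCast_ne_zero_of_isUnit hN)
    (IsReductionOf.pow_eq_one hred hpow')).symm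

omit [NumberField K] in
/-- **Transfer of triviality along a residual isomorphism.**  Let `ρ, ρ' : Γ_K → GL₂(ℚ̄_p)` be continuous with
residual representations `τ, τ'` which are ISOMORPHIC, and let `σ ∈ Γ_K` satisfy `ρ(σ)^N = ρ'(σ)^N = 1` with
`N ∈ ℤ̄_pˣ` (e.g. `σ` in a ramification group `Γ^u`, `u > 0`, at `ℓ ≠ p`, `N = ℓ^k`).  Then `ρ(σ) = 1 ↔ ρ'(σ) = 1`.
[cite: DarmonDiamondTaylor1995, §2.1, Prop. 2.6 and p. 54] -/
theorem FramedGaloisRep.apply_eq_one_iff_of_isResidualRepOf_equiv (ρ ρ' : FramedGaloisRep K (PadicAlgCl p) 2)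
    {τ τ' : Field.absoluteGaloisGroup K →* GL (Fin 2) (padicAlgClResidueField p)}
    (hτ : ρ.IsResidualRepOf (RingHom.id _) τ) (hτ' : ρ'.IsResidualRepOf (RingHom.id _) τ')
    (e : (glRepresentation τ).Equiv (glRepresentation τ')) {σ : Field.absoluteGaloisGroup K} {N : ℕ}
    (hN : IsUnit ((N : ℕ) : padicAlgClIntegers p)) (hσ : ρ σ ^ N = 1) (hσ' : ρ' σ ^ N = 1) :
    ρ σ = 1 ↔ ρ' σ = 1 := by
  rw [FramedGaloisRep.apply_eq_one_iff_of_isResidualRepOf ρ hτ hN hσ,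
    FramedGaloisRep.apply_eq_one_iff_of_isResidualRepOf ρ' hτ' hN hσ', ← MonoidHom.mem_ker, ← MonoidHom.mem_ker,
    ker_eq_of_equiv_glRepresentation e]

end Residual

end Summit.BirchSwinnertonDyer.BirchSwinnertonDyer.Theorems.SmallImageLambdaLowerThreeNsThetaPartner

end
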